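import Mathlib
import Summits.NavierStokesRegularity.NavierStokesRegularity.Theorems.FilamentSkeletonRssStadiumFarKernelBound
import Summits.NavierStokesRegularity.NavierStokesRegularity.Theorems.FilamentSkeletonRssStadiumFarMajorant
import Summits.NavierStokesRegularity.NavierStokesRegularity.Theorems.FilamentSkeletonRssStadiumFarPieceHolomorphic
import Summits.NavierStokesRegularity.NavierStokesRegularity.Theorems.FilamentSkeletonRssStadiumVerticalDisplacement
import Summits.NavierStokesRegularity.NavierStokesRegularity.Theorems.FilamentSkeletonRssNearStraightEscape
import Summits.NavierStokesRegularity.NavierStokesRegularity.Theorems.FilamentSkeletonRssStadiumTangentModulus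
import Summits.NavierStokesRegularity.NavierStokesRegularity.Theorems.FilamentSkeletonRssStadiumDeviationPackage

/-!
# The PARTNER piece of the matched Biot–Savart field is stadium-analytic — AS REGISTERED (`TangentSkeletonNearStraightL`,
# stmt-NavierStokesRegularity-23320, registered stub `stub_stripPropagation`, the `k ≠ j` summands; no contour shift)

Data in the stub's terms: the rectangle stadium `S = {|Im z| < hs, |Re z − cc| < L + hs}` of filament `j`, its curve `X` (unit speed) with holomorphic
extension `F` (`F = cplx ∘ X` on the real trace, `‖F′‖ ≤ 2`); a PARTNER curve `Y` (`C¹`, unit speed, tangent oscillation `≤ 1/2`) with continuous core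
`A ≥ 0`, `κ ≥ 0`, separated from `X`: `d₀ ≤ ‖X τ − Y σ‖` for all `τ, σ` (`d₀ = ρ√Γ` in the stub).  On the thinner stadium
`S' = {|Im z| < hs', |Re z − cc| < L + hs}` with `hs' ≤ hs`, `16 hs' ≤ d₀` (in the stub `hs' = cs√Γ/4 ≤ ρ√Γ/16` as `8cs ≤ ρ` — NO retype needed
for the partner part):
* `partner_pointwise` : for `z ∈ S'`, every source `σ`: the matched base `Σᵢ(Fᵢ(z) − Yᵢ(σ))² + κA(σ)` has real part `≥ (d/3)²` and the kernel
  `‖((base)^{3/2})⁻¹ • (Y′(σ) ⨯₃ (F(z) − Y(σ)))‖ ≤ 61/d²`, `d = ‖X(Re z) − Y(σ)‖` (Theorems.StadiumFarKernelBound with the vertical displacement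
  `‖F(z) − F(Re z)‖ ≤ 2|Im z| ≤ d/8`);
* `partner_majorant` : a `z`-uniform integrable Lorentzian majorant on the ball `|z − z₀| < d₀/4` (near-infimum source point, chord `≥ 7/8`,
  Theorems.StadiumFarMajorant);
* `partnerPiece_differentiableOn` : `z ↦ ∫σ kernel` is holomorphic on `S'` (Theorems.StadiumFarPieceHolomorphic, locally);
* `partnerPiece_norm_le` : `‖∫σ kernel‖ ≤ 5·(61·16/9)·π/((7/16)·(d₀/2))` — `O(1/d₀) = O(1/(ρ√Γ))`, so the partner contribution to `u∘X_j` is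
  `O(Γ/(ρ√Γ)) = O(√Γ) ≤ Cu√Γ log Γ`.
HONEST FRAMING: a tool for a HYPOTHETICAL filament skeleton on the NEGATIVE side of a MODEL route; nothing here bears on Navier–Stokes regularity or
blow-up.  `--supports stmt-NavierStokesRegularity-23320`.
-/

set_option linter.dupNamespace false

noncomputable section

namespace Summit.NavierStokesRegularity.NavierStokesRegularity.Theorems.StadiumPartnerPiece

open Set Metric MeasureTheory
open scoped InnerProductSpace Matrix
open Summit.NavierStokesRegularity.NavierStokesRegularity.Theorems.StadiumFarKernelBound
open Summit.NavierStokesRegularity.NavierStokesRegularity.Theorems.StadiumFarMajorant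
open Summit.NavierStokesRegularity.NavierStokesRegularity.Theorems.StadiumFarPieceHolomorphic
open Summit.NavierStokesRegularity.NavierStokesRegularity.Theorems.StadiumVerticalDisplacement
open Summit.NavierStokesRegularity.NavierStokesRegularity.Theorems.NearStraightEscape
open Summit.NavierStokesRegularity.NavierStokesRegularity.Theorems.StadiumTangentModulus
open Summit.NavierStokesRegularity.NavierStokesRegularity.Theorems.StadiumDeviationPackage

/-- The rectangle stadium is open. [folklore] -/
theorem isOpen_stadium (hs R cc : ℝ) : IsOpen {z : ℂ | |z.im| < hs ∧ |z.re - cc| < R} := by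
  have h1 : IsOpen {z : ℂ | |z.im| < hs} := isOpen_lt (continuous_abs.comp Complex.continuous_im) continuous_const
  have h2 : IsOpen {z : ℂ | |z.re - cc| < R} :=
    isOpen_lt (continuous_abs.comp (Complex.continuous_re.sub continuous_const)) continuous_const
  exact h1.inter h2

/-- A unit-speed curve is `1`-Lipschitz. [folklore] -/
theorem norm_sub_le_of_unit_speed {X : ℝ → EuclideanSpace ℝ (Fin 3)} (hX : Differentiable ℝ X) (hXu : ∀ τ, ‖deriv X τ‖ = 1)
    (a b : ℝ) : ‖X a - X b‖ ≤ |a - b| := by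
  have h := Convex.norm_image_sub_le_of_norm_deriv_le (s := Set.univ) (C := 1) (fun x _ => hX x)
    (fun x _ => (hXu x).le) convex_univ (mem_univ b) (mem_univ a)
  simpa using h

/-- **Pointwise: principal branch and the `61/d²` bound for a partner source.** [folklore] -/
theorem partner_pointwise {hs hs' L cc d₀ κ : ℝ} {F : ℂ → (Fin 3 → ℂ)}
    (hF : DifferentiableOn ℂ F {z : ℂ | |z.im| < hs ∧ |z.re - cc| < L + hs})
    (hM : ∀ z ∈ {z : ℂ | |z.im| < hs ∧ |z.re - cc| < L + hs}, ‖deriv F z‖ ≤ 2)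
    {X : ℝ → EuclideanSpace ℝ (Fin 3)}
    (hFX : ∀ r : ℝ, (r : ℂ) ∈ {z : ℂ | |z.im| < hs ∧ |z.re - cc| < L + hs} →
      F r = fun i => ((⟪X r, EuclideanSpace.single i (1:ℝ)⟫_ℝ : ℝ) : ℂ))
    {Y : ℝ → EuclideanSpace ℝ (Fin 3)} (hYu : ∀ σ, ‖deriv Y σ‖ = 1) {A : ℝ → ℝ} (hA : ∀ σ, 0 ≤ A σ) (hκ : 0 ≤ κ)
    (hd₀ : 0 < d₀) (hsep : ∀ τ σ, d₀ ≤ ‖X τ - Y σ‖) (hhs' : hs' ≤ hs) (h16 : 16 * hs' ≤ d₀)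
    {z : ℂ} (hz : z ∈ {z : ℂ | |z.im| < hs' ∧ |z.re - cc| < L + hs}) (σ : ℝ) :
    (‖X z.re - Y σ‖ / 3) ^ 2 ≤ ((∑ i, (F z i - ((Y σ i : ℝ) : ℂ)) ^ 2) + ((κ * A σ : ℝ) : ℂ)).re ∧
    ‖(((∑ i, (F z i - ((Y σ i : ℝ) : ℂ)) ^ 2) + ((κ * A σ : ℝ) : ℂ)) ^ ((3:ℂ) / 2))⁻¹ •
      ((fun i => ((deriv Y σ i : ℝ) : ℂ)) ⨯₃ (fun i => F z i - ((Y σ i : ℝ) : ℂ)))‖ ≤ 61 / ‖X z.re - Y σ‖ ^ 2 := by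
  set S : Set ℂ := {z : ℂ | |z.im| < hs ∧ |z.re - cc| < L + hs} with hS
  have hSo : IsOpen S := isOpen_stadium hs (L + hs) cc
  have hzim : |z.im| < hs' := hz.1
  have hzre : |z.re - cc| < L + hs := hz.2
  have hhs'0 : 0 < hs' := lt_of_le_of_lt (abs_nonneg _) hzim
  have hhs0 : 0 < hs := lt_of_lt_of_le hhs'0 hhs'
  -- the vertical segment from `Re z` to `z` lies in `S`
  have hseg : ∀ t ∈ Set.uIcc 0 z.im, ((z.re : ℝ) : ℂ) + (t : ℂ) * Complex.I ∈ S := by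
    intro t ht
    refine ⟨?_, by simpa using hzre⟩
    have ht' : |t| ≤ |z.im| := by
      rcases le_total 0 z.im with hu | hu
      · rw [uIcc_of_le hu] at ht
        rw [abs_of_nonneg ht.1, abs_of_nonneg hu]
        exact ht.2
      · rw [uIcc_of_ge hu] at ht
        rw [abs_of_nonpos ht.2, abs_of_nonpos hu]
        linarith [ht.1]
    have : ((((z.re : ℝ) : ℂ) + (t : ℂ) * Complex.I).im) = t := by simp
    rw [this]
    linarith
  have hvd0 := norm_sub_le_of_vertical_segment hSo hF hM hseg
  have hzeq : ((z.re : ℝ) : ℂ) + ((z.im : ℝ) : ℂ) * Complex.I = z := Complex.re_add_im z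
  rw [hzeq] at hvd0
  -- the real foot
  have hxS : ((z.re : ℝ) : ℂ) ∈ S := ⟨by simpa using hhs0, by simpa using hzre⟩
  have hFx : F (z.re : ℝ) = fun i => ((X z.re i : ℝ) : ℂ) := by
    rw [hFX _ hxS]; funext i; rw [inner_single_eq]
  -- decomposition `F z − Y σ = u + e`
  set u : EuclideanSpace ℝ (Fin 3) := X z.re - Y σ with hu
  set e : Fin 3 → ℂ := fun i => F z i - F (z.re : ℝ) i with he
  have hdecomp : (fun i => F z i - ((Y σ i : ℝ) : ℂ)) = fun i => ((u i : ℝ) : ℂ) + e i := by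
    funext i
    simp only [hu, he, hFx, PiLp.sub_apply, Complex.ofReal_sub]
    ring
  have hsum : (∑ i, (F z i - ((Y σ i : ℝ) : ℂ)) ^ 2) = ∑ i, (((u i : ℝ) : ℂ) + e i) ^ 2 :=
    Finset.sum_congr rfl fun i _ => by rw [congrFun hdecomp i]
  -- hypotheses of the far kernel bound
  have hd : 0 < ‖u‖ := lt_of_lt_of_le hd₀ (hsep _ _)
  have hev : ∀ i, ‖e i‖ ≤ 2 * |z.im| := fun i => (norm_le_pi_norm (F z - F (z.re : ℝ)) i).trans hvd0
  have hy : |z.im| ≤ ‖u‖ / 16 := by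
    have := hsep z.re σ
    linarith
  have ht : ‖(fun i => ((deriv Y σ i : ℝ) : ℂ))‖ ≤ 1 := by
    have h := norm_cplx_le (deriv Y σ)
    have e1 : (fun i => ((⟪deriv Y σ, EuclideanSpace.single i (1:ℝ)⟫_ℝ : ℝ) : ℂ)) = fun i => ((deriv Y σ i : ℝ) : ℂ) := by
      funext i; rw [inner_single_eq]
    rw [e1, hYu σ] at h
    exact h
  have hmain := far_kernel_norm_le u e (fun i => ((deriv Y σ i : ℝ) : ℂ)) hd rfl hev hy ht hκ (hA σ)
  rw [hdecomp, hsum]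
  exact hmain

/-- **Local uniform Lorentzian majorant.**  For every `z₀` there are `σ₀`, `a ≥ d₀` with: for every `z ∈ S'` with `‖z − z₀‖ < d₀/4` and
every `σ`, `‖kernel(z, σ)‖ ≤ 5·(61·16/9)·((7/16)²(σ−σ₀)² + a²)⁻¹`. [folklore] -/
theorem partner_majorant {hs hs' L cc d₀ κ : ℝ} {F : ℂ → (Fin 3 → ℂ)}
    (hF : DifferentiableOn ℂ F {z : ℂ | |z.im| < hs ∧ |z.re - cc| < L + hs})
    (hM : ∀ z ∈ {z : ℂ | |z.im| < hs ∧ |z.re - cc| < L + hs}, ‖deriv F z‖ ≤ 2)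
    {X : ℝ → EuclideanSpace ℝ (Fin 3)} (hX : Differentiable ℝ X) (hXu : ∀ τ, ‖deriv X τ‖ = 1)
    (hFX : ∀ r : ℝ, (r : ℂ) ∈ {z : ℂ | |z.im| < hs ∧ |z.re - cc| < L + hs} →
      F r = fun i => ((⟪X r, EuclideanSpace.single i (1:ℝ)⟫_ℝ : ℝ) : ℂ))
    {Y : ℝ → EuclideanSpace ℝ (Fin 3)} (hY : Differentiable ℝ Y) (hYu : ∀ σ, ‖deriv Y σ‖ = 1)
    (hYosc : ∀ τ σ, ‖deriv Y τ - deriv Y σ‖ ≤ 1 / 2) {A : ℝ → ℝ} (hA : ∀ σ, 0 ≤ A σ) (hκ : 0 ≤ κ)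
    (hd₀ : 0 < d₀) (hsep : ∀ τ σ, d₀ ≤ ‖X τ - Y σ‖) (hhs' : hs' ≤ hs) (h16 : 16 * hs' ≤ d₀) (z₀ : ℂ) :
    ∃ σ₀ a : ℝ, d₀ ≤ a ∧ ∀ z ∈ {z : ℂ | |z.im| < hs' ∧ |z.re - cc| < L + hs}, ‖z - z₀‖ < d₀ / 4 → ∀ σ : ℝ,
      ‖(((∑ i, (F z i - ((Y σ i : ℝ) : ℂ)) ^ 2) + ((κ * A σ : ℝ) : ℂ)) ^ ((3:ℂ) / 2))⁻¹ •
        ((fun i => ((deriv Y σ i : ℝ) : ℂ)) ⨯₃ (fun i => F z i - ((Y σ i : ℝ) : ℂ)))‖ ≤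
        5 * (61 * 16 / 9) * ((7 / 16) ^ 2 * (σ - σ₀) ^ 2 + a ^ 2)⁻¹ := by
  -- the distance function from the foot of `z₀` and its infimum
  set D : ℝ → ℝ := fun σ => ‖X z₀.re - Y σ‖ with hD
  have hDge : ∀ σ, d₀ ≤ D σ := fun σ => hsep _ _
  have hbdd : BddBelow (range D) := ⟨d₀, by rintro _ ⟨σ, rfl⟩; exact hDge σ⟩
  set m : ℝ := ⨅ σ, D σ with hm
  have hm_ge : d₀ ≤ m := le_ciInf hDge
  have hm_pos : 0 < m := lt_of_lt_of_le hd₀ hm_ge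
  have hm_le : ∀ σ, m ≤ D σ := fun σ => ciInf_le hbdd σ
  obtain ⟨σ₀, hσ₀⟩ : ∃ σ₀, D σ₀ < 2 * m := exists_lt_of_ciInf_lt (by linarith)
  refine ⟨σ₀, m, hm_ge, ?_⟩
  intro z hz hzz₀ σ
  -- the pointwise bound at `z`
  have hpt := (partner_pointwise hF hM hFX hYu hA hκ hd₀ hsep hhs' h16 hz σ).2
  -- `d_z(σ) ≥ (3/4) D σ`
  have hre : |z.re - z₀.re| < d₀ / 4 := by
    have h := Complex.abs_re_le_norm (z - z₀)
    rw [Complex.sub_re] at h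
    exact lt_of_le_of_lt h hzz₀
  have hXlip : ‖X z.re - X z₀.re‖ ≤ |z.re - z₀.re| := norm_sub_le_of_unit_speed hX hXu _ _
  have hdz : 3 / 4 * D σ ≤ ‖X z.re - Y σ‖ := by
    have h1 : D σ ≤ ‖X z.re - Y σ‖ + ‖X z.re - X z₀.re‖ := by
      have := norm_sub_le_norm_sub_add_norm_sub (X z₀.re) (X z.re) (Y σ)
      simp only [hD]
      rw [norm_sub_rev (X z₀.re) (X z.re)] at this
      linarith
    have h2 := hDge σ
    linarith
  have hDpos : 0 < D σ := lt_of_lt_of_le hd₀ (hDge σ)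
  have hdzpos : 0 < ‖X z.re - Y σ‖ := by linarith
  -- `61/d_z² ≤ (61·16/9)/D²`
  have hstep : 61 / ‖X z.re - Y σ‖ ^ 2 ≤ (61 * 16 / 9) / D σ ^ 2 := by
    rw [div_le_div_iff₀ (by positivity) (by positivity)]
    nlinarith [hdz, hDpos, hdzpos]
  -- the Lorentzian majorant: `m ≤ D σ` and `(7/16)|σ − σ₀| − m ≤ D σ`
  have hchord : 7 / 8 * |σ - σ₀| ≤ ‖Y σ - Y σ₀‖ := chord_ge_seven_eighths hY hYu hYosc le_rfl σ₀ σ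
  have hDlow : 7 / 8 * |σ - σ₀| - 2 * m ≤ D σ := by
    have h1 : ‖Y σ - Y σ₀‖ ≤ D σ + D σ₀ := by
      have := norm_sub_le_norm_sub_add_norm_sub (Y σ) (X z₀.re) (Y σ₀)
      simp only [hD]
      rw [norm_sub_rev (Y σ) (X z₀.re)] at this
      linarith
    linarith
  have h2 : 7 / 16 * |σ - σ₀| - m ≤ D σ := by
    rcases le_or_gt m (7 / 16 * |σ - σ₀|) with h | h
    · linarith
    · linarith [hm_le σ, abs_nonneg (σ - σ₀)]
  have hmaj := far_majorant_le (C := 61 * 16 / 9) (σ₀ := σ₀) (σ := σ) hm_pos (by norm_num : (0:ℝ) ≤ 7 / 16)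
    (by norm_num) (hm_le σ) h2
  exact hpt.trans (hstep.trans hmaj)

/-- **The partner piece is holomorphic on the thinner stadium** (`16 hs' ≤ d₀`, `hs' ≤ hs`). [folklore] -/
theorem partnerPiece_differentiableOn {hs hs' L cc d₀ κ : ℝ} {F : ℂ → (Fin 3 → ℂ)}
    (hF : DifferentiableOn ℂ F {z : ℂ | |z.im| < hs ∧ |z.re - cc| < L + hs})
    (hM : ∀ z ∈ {z : ℂ | |z.im| < hs ∧ |z.re - cc| < L + hs}, ‖deriv F z‖ ≤ 2)
    {X : ℝ → EuclideanSpace ℝ (Fin 3)} (hX : Differentiable ℝ X) (hXu : ∀ τ, ‖deriv X τ‖ = 1)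
    (hFX : ∀ r : ℝ, (r : ℂ) ∈ {z : ℂ | |z.im| < hs ∧ |z.re - cc| < L + hs} →
      F r = fun i => ((⟪X r, EuclideanSpace.single i (1:ℝ)⟫_ℝ : ℝ) : ℂ))
    {Y : ℝ → EuclideanSpace ℝ (Fin 3)} (hY : ContDiff ℝ 1 Y) (hYu : ∀ σ, ‖deriv Y σ‖ = 1)
    (hYosc : ∀ τ σ, ‖deriv Y τ - deriv Y σ‖ ≤ 1 / 2) {A : ℝ → ℝ} (hAc : Continuous A) (hA : ∀ σ, 0 ≤ A σ) (hκ : 0 ≤ κ)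
    (hd₀ : 0 < d₀) (hsep : ∀ τ σ, d₀ ≤ ‖X τ - Y σ‖) (hhs' : hs' ≤ hs) (h16 : 16 * hs' ≤ d₀) :
    DifferentiableOn ℂ (fun z => ∫ σ : ℝ,
      (((∑ i, (F z i - ((Y σ i : ℝ) : ℂ)) ^ 2) + ((κ * A σ : ℝ) : ℂ)) ^ ((3:ℂ) / 2))⁻¹ •
        ((fun i => ((deriv Y σ i : ℝ) : ℂ)) ⨯₃ (fun i => F z i - ((Y σ i : ℝ) : ℂ))))
      {z : ℂ | |z.im| < hs' ∧ |z.re - cc| < L + hs} := by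
  set S' : Set ℂ := {z : ℂ | |z.im| < hs' ∧ |z.re - cc| < L + hs} with hS'
  have hS'o : IsOpen S' := isOpen_stadium hs' (L + hs) cc
  have hYd : Differentiable ℝ Y := hY.differentiable (by simp)
  intro z₀ hz₀
  obtain ⟨σ₀, a, ha, hmaj⟩ := partner_majorant hF hM hX hXu hFX hYd hYu hYosc hA hκ hd₀ hsep hhs' h16 z₀
  have ha0 : 0 < a := lt_of_lt_of_le hd₀ ha
  set V : Set ℂ := Metric.ball z₀ (d₀ / 4) ∩ S' with hV
  have hVo : IsOpen V := Metric.isOpen_ball.inter hS'o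
  have hz₀V : z₀ ∈ V := ⟨Metric.mem_ball_self (by positivity), hz₀⟩
  have hVS : V ⊆ {z : ℂ | |z.im| < hs ∧ |z.re - cc| < L + hs} := fun z hz => ⟨lt_of_lt_of_le hz.2.1 hhs', hz.2.2⟩
  have hpos : ∀ z ∈ V, ∀ σ ∈ (Set.univ : Set ℝ),
      0 < ((∑ i, (F z i - ((Y σ i : ℝ) : ℂ)) ^ 2) + ((κ * A σ : ℝ) : ℂ)).re := by
    intro z hz σ _
    have h := (partner_pointwise hF hM hFX hYu hA hκ hd₀ hsep hhs' h16 hz.2 σ).1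
    have hd : 0 < ‖X z.re - Y σ‖ := lt_of_lt_of_le hd₀ (hsep _ _)
    exact lt_of_lt_of_le (by positivity) h
  have hbound : IntegrableOn (fun σ : ℝ => 5 * (61 * 16 / 9) * ((7 / 16) ^ 2 * (σ - σ₀) ^ 2 + a ^ 2)⁻¹) Set.univ := by
    rw [integrableOn_univ]
    exact (integrable_lorentzian ha0 (by norm_num : (7 / 16 : ℝ) ≠ 0) σ₀).const_mul _
  have hdom : ∀ z ∈ V, ∀ σ ∈ (Set.univ : Set ℝ),
      ‖(((∑ i, (F z i - ((Y σ i : ℝ) : ℂ)) ^ 2) + ((κ * A σ : ℝ) : ℂ)) ^ ((3:ℂ) / 2))⁻¹ •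
        ((fun i => ((deriv Y σ i : ℝ) : ℂ)) ⨯₃ (fun i => F z i - ((Y σ i : ℝ) : ℂ)))‖ ≤
        5 * (61 * 16 / 9) * ((7 / 16) ^ 2 * (σ - σ₀) ^ 2 + a ^ 2)⁻¹ := by
    intro z hz σ _
    have hzz : ‖z - z₀‖ < d₀ / 4 := by
      have := hz.1; rwa [Metric.mem_ball, dist_eq_norm] at this
    exact hmaj z hz.2 hzz σ
  have h := differentiableOn_farPiece hVo (hF.mono hVS) hY hAc MeasurableSet.univ hpos hbound hdom
  simp only [Measure.restrict_univ] at h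
  exact (h.differentiableAt (hVo.mem_nhds hz₀V)).differentiableWithinAt

/-- **The partner piece is bounded by `O(1/d₀)`** on the thinner stadium: `‖∫σ kernel‖ ≤ 5·(61·16/9)·π/((7/16)·d₀)`. [folklore] -/
theorem partnerPiece_norm_le {hs hs' L cc d₀ κ : ℝ} {F : ℂ → (Fin 3 → ℂ)}
    (hF : DifferentiableOn ℂ F {z : ℂ | |z.im| < hs ∧ |z.re - cc| < L + hs})
    (hM : ∀ z ∈ {z : ℂ | |z.im| < hs ∧ |z.re - cc| < L + hs}, ‖deriv F z‖ ≤ 2)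
    {X : ℝ → EuclideanSpace ℝ (Fin 3)} (hX : Differentiable ℝ X) (hXu : ∀ τ, ‖deriv X τ‖ = 1)
    (hFX : ∀ r : ℝ, (r : ℂ) ∈ {z : ℂ | |z.im| < hs ∧ |z.re - cc| < L + hs} →
      F r = fun i => ((⟪X r, EuclideanSpace.single i (1:ℝ)⟫_ℝ : ℝ) : ℂ))
    {Y : ℝ → EuclideanSpace ℝ (Fin 3)} (hY : Differentiable ℝ Y) (hYu : ∀ σ, ‖deriv Y σ‖ = 1)
    (hYosc : ∀ τ σ, ‖deriv Y τ - deriv Y σ‖ ≤ 1 / 2) {A : ℝ → ℝ} (hA : ∀ σ, 0 ≤ A σ) (hκ : 0 ≤ κ)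
    (hd₀ : 0 < d₀) (hsep : ∀ τ σ, d₀ ≤ ‖X τ - Y σ‖) (hhs' : hs' ≤ hs) (h16 : 16 * hs' ≤ d₀)
    {z : ℂ} (hz : z ∈ {z : ℂ | |z.im| < hs' ∧ |z.re - cc| < L + hs}) :
    ‖∫ σ : ℝ, (((∑ i, (F z i - ((Y σ i : ℝ) : ℂ)) ^ 2) + ((κ * A σ : ℝ) : ℂ)) ^ ((3:ℂ) / 2))⁻¹ •
        ((fun i => ((deriv Y σ i : ℝ) : ℂ)) ⨯₃ (fun i => F z i - ((Y σ i : ℝ) : ℂ)))‖ ≤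
      5 * (61 * 16 / 9) * (Real.pi / ((7 / 16) * d₀)) := by
  obtain ⟨σ₀, a, ha, hmaj⟩ := partner_majorant hF hM hX hXu hFX hY hYu hYosc hA hκ hd₀ hsep hhs' h16 z
  have ha0 : 0 < a := lt_of_lt_of_le hd₀ ha
  have hint : Integrable (fun σ : ℝ => 5 * (61 * 16 / 9) * ((7 / 16) ^ 2 * (σ - σ₀) ^ 2 + a ^ 2)⁻¹) :=
    (integrable_lorentzian ha0 (by norm_num : (7 / 16 : ℝ) ≠ 0) σ₀).const_mul _
  have hself : ‖z - z‖ < d₀ / 4 := by simp; positivity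
  have h1 := norm_integral_le_of_norm_le hint (Filter.Eventually.of_forall fun σ => hmaj z hz hself σ)
  refine h1.trans ?_
  rw [integral_const_mul, integral_lorentzian ha0 (by norm_num : (7 / 16 : ℝ) ≠ 0) σ₀]
  have hk : |(7 / 16 : ℝ)| = 7 / 16 := abs_of_pos (by norm_num)
  rw [hk]
  have hπ := Real.pi_pos
  apply mul_le_mul_of_nonneg_left _ (by norm_num)
  rw [div_le_div_iff₀ (by positivity) (by positivity)]
  have : Real.pi * (7 / 16 * d₀) ≤ Real.pi * (7 / 16 * a) := by nlinarith
  linarith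

end Summit.NavierStokesRegularity.NavierStokesRegularity.Theorems.StadiumPartnerPiece

end
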